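import Literature.AnabelianGeometry.EtaleTheta.Discharge.Sec5ThetaDivisorsPullThetaTwistTower
import Literature.AnabelianGeometry.EtaleTheta.Discharge.Sec4MuTorsionThetaTwistTower
import HarnessLib

/-!
# [EtTh] Prop. 1.4 / Def. 3.3 (iii) at the FOURTH tower model: the theta function `Θ̈` PROPER (not a root) is a SECTION of `B₀` over
# EVERY connected covering whose stabilisers are TRANSLATION-FREE — `div₀ Θ̈ = ([cusps] − [D₁])^{N_m}` in level-`m` units, coprime halves

S. Mochizuki, *The étale theta function and its Frobenioid-theoretic manifestations*, Publ. RIMS **45** (2009) [MochizukiEtTh2009], Prop. 1.4 (i)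
p.247 (PDF p.21) (zeros of `Θ̈` = the cusps of `Ÿ`, divisor of poles `D₁`), Prop. 1.4 (ii) p.248 (functional equation of `Θ̈` under the
translation `Gal(Y/X) ≅ ℤ` — so `Θ̈` is a function on `Ÿ`, NOT on a quotient with translations), Rmk. 1.3.1 p.247, Def. 3.3 (iii) p.299
(PDF p.73) (`B₀(Y) = Mero(Z_∞)^{Gal(Z_∞/Y)}`, `Φ₀(Y)`, «log-divisor of zeroes and poles»), Def. 4.1 (i) p.312 (PDF p.86), §5 p.330 (PDF p.104)
(«the theta function determines an element of `O^×(A_⊙^birat)`», `A_⊙^bs` the `Ÿ`-covering).  [cite: MochizukiEtTh2009, Def 3.3 (iii) p.73]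
PAGE CONVENTION for [EtTh]: «printed N (PDF p.M)», N = M + 226.

CLASS (b) DATUM (definitions + theorems; abc-iut cell, layer L2, seat abc-iut-L2-d2 gen 8; plan/L2/SUBDAG-EtTh-JUNCTION.md slot D5 AT THE
JUNCTION CARRIER OF RECORD — the Ÿ-anchor `(Compat₃′/φ(ιX(Π^tp_Ÿ)), 0)` of abc-iut-L2-t3's `settingSmallYdd` (p504077) — FILE D1: the
tower-level layer, GENERIC over a connected `Compat₃′`-set `S` with a base point `s₀` whose stabiliser is TRANSLATION-FREE).  The anchors
`Y_n = Compat₃′/V_n` of FILE A1 (`ThetaFamilyOfThetaTwistTower`, p505973) carry the level-`n` ROOT `Θ̈_n = Θ̈^{1/N_n}`; here the function is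
`Θ̈` itself, read at level `m` as `Θ̈_m^{N_m}` (the image of the level-`0` theta function under the tower's transition), which needs NO
Kummer-class condition on the stabiliser.  Consumed BY NAME, nothing restated: FILE A1 (`thetaFn`, `divisor_thetaFn`), this seat's
`actDIV_eq_of_φ₃_eq_one` (p509439), FILE 4's `toAdd_snd_actFn` / `φ₃` (p493549), gen-7's `exists_bZero_of_invariant` (p500836),
abc-iut-L2-t3's `shear₀_zero`, `thetaZerosPhi`, `actDIV_thetaZeros`, `coord`, `perfection_coprime_iff_coord`.
* §0 `exists_phiZero_of_invariant` — `Φ₀(S) = Div⁺(Z_∞)^{Stab(s₀)}` on a CONNECTED `S` (the `Φ₀`-twin of gen-7's `B₀` lemma; any `GaloisAction`).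
* §1 **`actFn_pow_N_of_φ₃_eq_one`** — at level `m` EVERY `N_m`-th power is FIXED by EVERY translation-free `g ∈ Compat₃′` (the Kummer twist
  and the character land in `μ_{N_m}`, killed by the exponent; the shear of a translation-free element is trivial); **`thetaProper m :=
  thetaFn m ^ N_m`** — `Θ̈` proper at level `m` — with `divisor (thetaProper m) = ([cusps]/[D₁])^{N_m}`.
* §2 over `(S, s₀)` with `hstab : ∀ g, g·s₀ = s₀ → φ₃ g = 1`: **`thetaProperFam ∈ B₀(S)`** (value `Θ̈` at `s₀`), **`thetaPolesFamOf ∈ Φ₀(S)`**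
  (value `D₁` at `s₀`; never meets a cusp), `thetaZerosFamOf` (the cusps; never meets a component), **`divZeroHom_thetaProperFam :
  div₀ Θ̈ = [zeros^{N_m}]/[poles^{N_m}]`**, disjoint coordinate supports and COPRIMALITY of the two `N_m`-th powers in `Φ₀(S)^pf`.
FILE D2 (`ThetaProperFractionPairSmallIndex`) reads this at `S := gset (repr A)` of abc-iut-L2-t3's small-index model and builds
`Θ̈ ∈ O^×(A_⊙^birat)` with its Def. 4.1 (i) fraction-pair at the Ÿ-anchor under «`φ₃ ∘ φ ∘ ιX = 1` on `Π^tp_Ÿ`».  HONEST FRAMING: class-(b)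
combinatorial DESIGN model (NOT the tempered Frobenioid of a Tate curve; (β) deviation of record: the torsion sign of Prop. 1.4 (ii) is not
carried); no Prop-valued fact, no instance, no notation, no sorry; nothing here bears on [IUTchIII] Cor. 3.12; no side taken; typed ≠ proved.
-/

noncomputable section

namespace Literature.AnabelianGeometry.EtaleTheta

open CategoryTheory Opposite Function Literature.AlgebraicGeometry.Frobenioids Literature.AlgebraicGeometry.Frobenioids.QuasiTemperoid
  Literature.AnabelianGeometry.SemiGraphs LogDivisorModel LogDivisorModel.GaloisAction LogDivisorTower

universe u

/-! ## §0 Equivariant log-divisor families on a connected `G`-set are their values at one point -/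

namespace LogDivisorModel.GaloisAction

variable {Z : LogDivisorModel.{u}} {G : Type u} [Group G] (A : Z.GaloisAction G) {S : Action (Type u) G}

/-- **`Φ₀(S) = Div⁺(Z_∞)^{Stab(s₀)}` on a CONNECTED `S`**: every effective Cartier log-divisor fixed by the stabiliser of `s₀` is the value at
`s₀` of an equivariant family (`s = g·s₀ ↦ g·d`, well defined by the invariance). [cite: MochizukiEtTh2009, Def 3.3 (iii) p.73] -/
theorem exists_phiZero_of_invariant (hS : isConnectedGSet S) (s₀ : S.V) {d : Z.DIV} (hd : d ∈ Z.Divplus)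
    (hinv : ∀ g : G, S.ρ g s₀ = s₀ → A.actDIV g d = d) : ∃ φ : A.phiZero S, φ.1 s₀ = d := by
  classical
  have hmul : ∀ (g h : G) (s : S.V), S.ρ (g * h) s = S.ρ g (S.ρ h s) := fun g h s => by rw [map_mul]; rfl
  let τ : S.V → G := fun s => (hS.2 s₀ s).choose
  have hτ : ∀ s, S.ρ (τ s) s₀ = s := fun s => (hS.2 s₀ s).choose_spec
  have hwd : ∀ g h : G, S.ρ g s₀ = S.ρ h s₀ → A.actDIV g d = A.actDIV h d := by
    intro g h hgh
    have h1 : S.ρ (h⁻¹ * g) s₀ = s₀ := by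
      rw [hmul, hgh, ← hmul, inv_mul_cancel, map_one]; rfl
    have h2 : A.actDIV h (A.actDIV (h⁻¹ * g) d) = A.actDIV g d := by
      rw [← MulAut.mul_apply, ← map_mul, mul_inv_cancel_left]
    rw [← h2, hinv _ h1]
  refine ⟨⟨fun s => A.actDIV (τ s) d, fun s => ⟨A.act_mem_Div _ hd.1, A.act_mem_DIVplus _ hd.2⟩, fun g s => ?_⟩, ?_⟩
  · change A.actDIV (τ (S.ρ g s)) d = A.actDIV g (A.actDIV (τ s) d)
    rw [← MulAut.mul_apply, ← map_mul]
    exact hwd _ _ (by rw [hτ, hmul, hτ])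
  · change A.actDIV (τ s₀) d = d
    have h := hwd (τ s₀) 1 (by rw [hτ, map_one]; rfl)
    rw [h, map_one, MulAut.one_apply]

end LogDivisorModel.GaloisAction

namespace ThetaTwistTowerTempered

open LogDivisorModel.TateTowerThetaTwist TateTowerKummerTwistRShear
open TateTowerKummerTwist (N coe_N)

/-! ## §1 Every `N_m`-th power is fixed by every translation-free element; `Θ̈` proper at level `m` -/

section Level

variable (m : ℕ)

/-- The skeleton part is FIXED by a translation-free element (no shear). [cite: MochizukiEtTh2009, Def 3.3 (iii) p.73] -/
theorem snd_actFn_of_φ₃_eq_one {g : Compat 3 thetaShear} (hg : φ₃ g = 1) (x : (towerC₃sf.Z m).Fn) :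
    ((towerC₃sf.act m).actFn g x).1.2 = x.1.2 :=
  Multiplicative.toAdd.injective (by rw [toAdd_snd_actFn, hg, toAdd_one, shear₀_zero]; rfl)

/-- **At level `m` EVERY `N_m`-th power is FIXED by EVERY translation-free element of «GRP₃′»** — the `μ_{N_m}`-coordinate of any function
dies in the `N_m`-th power (exponent of `μ_{N_m}`), so the Kummer twist and the character are invisible, and a translation-free element does
not shear the skeleton part. [cite: MochizukiEtTh2009, §1 p.13] -/
theorem actFn_pow_N_of_φ₃_eq_one {g : Compat 3 thetaShear} (hg : φ₃ g = 1) (x : (towerC₃sf.Z m).Fn) :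
    (towerC₃sf.act m).actFn g (x ^ ((N m : ℕ+) : ℕ)) = x ^ ((N m : ℕ+) : ℕ) := by
  have hcard : Fintype.card (TateTowerKummerTwist.MuN m) = ((N m : ℕ+) : ℕ) := by rw [Fintype.card_multiplicative, ZMod.card]
  have h1 : ∀ y : (towerC₃sf.Z m).Fn, (y ^ ((N m : ℕ+) : ℕ)).1.1 = 1 := fun y => by
    change y.1.1 ^ ((N m : ℕ+) : ℕ) = 1
    have e : y.1.1 ^ Fintype.card (TateTowerKummerTwist.MuN m) = 1 := pow_card_eq_one
    rwa [hcard] at e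
  rw [map_pow]
  refine Subtype.ext (Prod.ext ((h1 _).trans (h1 x).symm) ?_)
  change ((towerC₃sf.act m).actFn g x).1.2 ^ ((N m : ℕ+) : ℕ) = x.1.2 ^ ((N m : ℕ+) : ℕ)
  rw [snd_actFn_of_φ₃_eq_one m hg]

/-- **`Θ̈` PROPER at level `m`: `Θ̈ = Θ̈_m^{N_m}`** (`Θ̈_m` the level-`m` root `thetaFn m`; `N_m = (m+1)!` the ramification index of the level over
level `0`, so this IS the level-`0` theta function read at level `m`). [cite: MochizukiEtTh2009, Prop 1.4 p.21] -/
def thetaProper : (towerC₃sf.Z m).Fn := thetaFn m ^ ((N m : ℕ+) : ℕ)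

/-- `Θ̈` is log-meromorphic. [cite: MochizukiEtTh2009, Def 3.1 p.70] -/
theorem thetaProper_mem_logMero : thetaProper m ∈ (towerC₃sf.Z m).logMero := trivial

/-- **`Θ̈` is FIXED by every translation-free element** (no condition on its Kummer classes). [cite: MochizukiEtTh2009, Prop 1.4 p.22] -/
theorem actFn_thetaProper_of_φ₃_eq_one {g : Compat 3 thetaShear} (hg : φ₃ g = 1) :
    (towerC₃sf.act m).actFn g (thetaProper m) = thetaProper m :=
  actFn_pow_N_of_φ₃_eq_one m hg _

/-- **`divisor Θ̈ = ([cusps] − [D₁])^{N_m}` in level-`m` units** (Prop. 1.4 (i) — the level's units are `1/N_m` of the level-`0` units).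
[cite: MochizukiEtTh2009, Prop 1.4 p.21] -/
theorem divisor_thetaProper :
    (towerC₃sf.Z m).divisor ⟨thetaProper m, thetaProper_mem_logMero m⟩ =
      (((TateTowerTheta.thetaZeros : TateTowerTheta.model.DIV) : (towerC₃sf.Z m).DIV) /
        ((TateTowerTheta.thetaPoles : TateTowerTheta.model.DIV) : (towerC₃sf.Z m).DIV)) ^ ((N m : ℕ+) : ℕ) := by
  have e : (⟨thetaProper m, thetaProper_mem_logMero m⟩ : (towerC₃sf.Z m).logMero) =
      ⟨thetaFn m, thetaFn_mem_logMero m⟩ ^ ((N m : ℕ+) : ℕ) := Subtype.ext rfl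
  rw [e, map_pow, divisor_thetaFn]
  rfl

end Level

/-! ## §2 `Θ̈`, its polar family and `div₀ Θ̈` over any connected covering with translation-free stabilisers -/

section Family

variable {S : Action (Type 0) (Compat 3 thetaShear)} (hS : isConnectedGSet S) (s₀ : S.V)
  (hstab : ∀ g : Compat 3 thetaShear, S.ρ g s₀ = s₀ → φ₃ g = 1) (m : ℕ)

include hS hstab in
/-- A section of `B₀(S)` at level `m` with value `Θ̈` at `s₀` exists (the stabiliser is translation-free). [cite: MochizukiEtTh2009, Def 3.3 (iii) p.73] -/
theorem exists_thetaProperFam : ∃ b : (towerC₃sf.act m).bZero S, b.1 s₀ = thetaProper m :=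
  (towerC₃sf.act m).exists_bZero_of_invariant hS s₀ (thetaProper_mem_logMero m) fun g hg =>
    actFn_thetaProper_of_φ₃_eq_one m (hstab g hg)

/-- **THE THETA FUNCTION `Θ̈ ∈ B₀(S)`** over the connected covering `S` with translation-free stabilisers (level `m`): the equivariant family
with value `Θ̈` at `s₀` — print's `Θ̈ ∈ K_Ÿ` (§5 p.330) at every covering dominating the `Ÿ`-analogue. [cite: MochizukiEtTh2009, §5 p.330] -/
def thetaProperFam : (towerC₃sf.act m).bZero S := (exists_thetaProperFam hS s₀ hstab m).choose

/-- `Θ̈(s₀) = Θ̈`. [cite: MochizukiEtTh2009, §5 p.330] -/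
theorem thetaProperFam_apply_base : (thetaProperFam hS s₀ hstab m).1 s₀ = thetaProper m :=
  (exists_thetaProperFam hS s₀ hstab m).choose_spec

/-- `Θ̈(k·s₀) = k·Θ̈`. [cite: MochizukiEtTh2009, §5 p.330] -/
theorem thetaProperFam_apply_ρ (k : Compat 3 thetaShear) :
    (thetaProperFam hS s₀ hstab m).1 (S.ρ k s₀) = (towerC₃sf.act m).actFn k (thetaProper m) := by
  rw [(thetaProperFam hS s₀ hstab m).2.2 k s₀, thetaProperFam_apply_base]

include hS hstab in
/-- A section of `Φ₀(S)` (level `m`) with value `D₁` at `s₀` exists (translation-free elements fix every log-divisor).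
[cite: MochizukiEtTh2009, Def 3.3 (iii) p.73] -/
theorem exists_thetaPolesFamOf : ∃ φ : (towerC₃sf.act m).phiZero S,
    φ.1 s₀ = ((TateTowerTheta.thetaPoles : TateTowerTheta.model.DIV) : (towerC₃sf.Z m).DIV) :=
  (towerC₃sf.act m).exists_phiZero_of_invariant hS s₀ (d := ((TateTowerTheta.thetaPoles : TateTowerTheta.model.DIV) : (towerC₃sf.Z m).DIV))
    ⟨trivial, TateTowerTheta.thetaPoles.2⟩ fun g hg => actDIV_eq_of_φ₃_eq_one m (hstab g hg) _

/-- **THE FAMILY OF POLAR DIVISORS on `S`** (level `m`): value `k·D₁` at `k·s₀`. [cite: MochizukiEtTh2009, Prop 1.4 p.21] -/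
def thetaPolesFamOf : (towerC₃sf.act m).phiZero S := (exists_thetaPolesFamOf hS s₀ hstab m).choose

/-- Its value at `s₀` is `D₁`. [cite: MochizukiEtTh2009, Prop 1.4 p.21] -/
theorem thetaPolesFamOf_apply_base :
    (thetaPolesFamOf hS s₀ hstab m).1 s₀ = ((TateTowerTheta.thetaPoles : TateTowerTheta.model.DIV) : (towerC₃sf.Z m).DIV) :=
  (exists_thetaPolesFamOf hS s₀ hstab m).choose_spec

/-- **The polar family never meets a cusp.** [cite: MochizukiEtTh2009, Prop 1.4 p.21] -/
theorem toAdd_thetaPolesFamOf_inl (y : S.V) (c : TateTowerTheta.Cusp) :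
    Multiplicative.toAdd ((thetaPolesFamOf hS s₀ hstab m).1 y) (Sum.inl c) = 0 := by
  obtain ⟨k, rfl⟩ := hS.2 s₀ y
  rw [(thetaPolesFamOf hS s₀ hstab m).2.2 k s₀, thetaPolesFamOf_apply_base]
  obtain ⟨j, b⟩ := c
  change Multiplicative.toAdd (TateTowerTheta.shiftDIV (Multiplicative.toAdd (Multiplicative.ofAdd
    (Multiplicative.toAdd (k : Grp 3 thetaShear).right.2))) (Multiplicative.ofAdd TateTowerTheta.polesFun)) (Sum.inl (j, b)) = 0
  rw [TateTowerTheta.toAdd_shiftDIV, toAdd_ofAdd, TateTowerTheta.shiftIdx_symm_inl]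
  rfl

variable (S) in
/-- **THE FAMILY OF ZERO DIVISORS on `S`** (level `m`): the constant family of the cusps. [cite: MochizukiEtTh2009, Prop 1.4 p.21] -/
def thetaZerosFamOf : (towerC₃sf.act m).phiZero S := TateTowerTheta.thetaZerosPhi φ₃ S

/-- Its values. [cite: MochizukiEtTh2009, Prop 1.4 p.21] -/
@[simp] theorem thetaZerosFamOf_apply (y : S.V) :
    (thetaZerosFamOf S m).1 y = ((TateTowerTheta.thetaZeros : TateTowerTheta.model.DIV) : (towerC₃sf.Z m).DIV) := rfl

/-- **The zero family never meets a component.** [cite: MochizukiEtTh2009, Prop 1.4 p.21] -/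
theorem toAdd_thetaZerosFamOf_inr (y : S.V) (j : ℤ) : Multiplicative.toAdd ((thetaZerosFamOf S m).1 y) (Sum.inr j) = 0 := rfl

/-- The divisor of `Θ̈` at the base point. [cite: MochizukiEtTh2009, Prop 1.4 p.21] -/
theorem divAt_thetaProperFam_base : (towerC₃sf.act m).divAt S (thetaProperFam hS s₀ hstab m) s₀ =
    (((TateTowerTheta.thetaZeros : TateTowerTheta.model.DIV) : (towerC₃sf.Z m).DIV) /
      ((TateTowerTheta.thetaPoles : TateTowerTheta.model.DIV) : (towerC₃sf.Z m).DIV)) ^ ((N m : ℕ+) : ℕ) := by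
  have e : (⟨(thetaProperFam hS s₀ hstab m).1 s₀, (thetaProperFam hS s₀ hstab m).2.1 s₀⟩ : (towerC₃sf.Z m).logMero) =
      ⟨thetaProper m, thetaProper_mem_logMero m⟩ := Subtype.ext (thetaProperFam_apply_base hS s₀ hstab m)
  rw [divAt, e]
  exact divisor_thetaProper m

/-- **`div₀ Θ̈ = [zeros^{N_m}] / [poles^{N_m}]` in `Φ₀(S)^gp`** (Def. 3.3 (iii)'s «log-divisor of zeroes and poles» of the theta function,
level-`m` units). [cite: MochizukiEtTh2009, Def 3.3 (iii) p.73] -/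
theorem divZeroHom_thetaProperFam : (towerC₃sf.act m).divZeroHom S (thetaProperFam hS s₀ hstab m) =
    Algebra.GrothendieckGroup.of (thetaZerosFamOf S m ^ ((N m : ℕ+) : ℕ)) /
      Algebra.GrothendieckGroup.of (thetaPolesFamOf hS s₀ hstab m ^ ((N m : ℕ+) : ℕ)) := by
  refine ((towerC₃sf.act m).divZeroHom_eq_div_iff _ _ _ _).2 fun y => ?_
  obtain ⟨k, rfl⟩ := hS.2 s₀ y
  have hP : ((thetaPolesFamOf hS s₀ hstab m ^ ((N m : ℕ+) : ℕ)).1 (S.ρ k s₀)) =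
      (towerC₃sf.act m).actDIV k (((TateTowerTheta.thetaPoles : TateTowerTheta.model.DIV) : (towerC₃sf.Z m).DIV) ^ ((N m : ℕ+) : ℕ)) := by
    change ((thetaPolesFamOf hS s₀ hstab m).1 (S.ρ k s₀)) ^ ((N m : ℕ+) : ℕ) = _
    rw [(thetaPolesFamOf hS s₀ hstab m).2.2 k s₀, thetaPolesFamOf_apply_base]
    exact (map_pow _ _ _).symm
  have hZ : ((thetaZerosFamOf S m ^ ((N m : ℕ+) : ℕ)).1 (S.ρ k s₀)) =
      (towerC₃sf.act m).actDIV k (((TateTowerTheta.thetaZeros : TateTowerTheta.model.DIV) : (towerC₃sf.Z m).DIV) ^ ((N m : ℕ+) : ℕ)) := by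
    change ((thetaZerosFamOf S m).1 (S.ρ k s₀)) ^ ((N m : ℕ+) : ℕ) = _
    rw [thetaZerosFamOf_apply]
    exact (congrArg (· ^ ((N m : ℕ+) : ℕ)) (TateTowerTheta.actDIV_thetaZeros φ₃ k).symm).trans (map_pow _ _ _).symm
  rw [divAt_ρ, divAt_thetaProperFam_base, hP, hZ, ← map_mul]
  have h : (((TateTowerTheta.thetaZeros : TateTowerTheta.model.DIV) : (towerC₃sf.Z m).DIV) /
      ((TateTowerTheta.thetaPoles : TateTowerTheta.model.DIV) : (towerC₃sf.Z m).DIV)) ^ ((N m : ℕ+) : ℕ) *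
      ((TateTowerTheta.thetaPoles : TateTowerTheta.model.DIV) : (towerC₃sf.Z m).DIV) ^ ((N m : ℕ+) : ℕ) =
      ((TateTowerTheta.thetaZeros : TateTowerTheta.model.DIV) : (towerC₃sf.Z m).DIV) ^ ((N m : ℕ+) : ℕ) := by
    rw [div_pow, div_mul_cancel]
  exact congrArg ((towerC₃sf.act m).actDIV k) h

/-- **The `N_m`-th powers of the two families have DISJOINT COORDINATE SUPPORTS** (cusps vs components). [cite: MochizukiEtTh2009, Def 4.1 (i) p.86] -/
theorem coord_thetaZerosFamOf_pow_eq_one_or (y : S.V) (x : TateTowerTheta.Idx) :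
    TateTowerTheta.coord φ₃ S y x (thetaZerosFamOf S m ^ ((N m : ℕ+) : ℕ)) = 1 ∨
      TateTowerTheta.coord φ₃ S y x (thetaPolesFamOf hS s₀ hstab m ^ ((N m : ℕ+) : ℕ)) = 1 := by
  rcases x with c | j
  · refine Or.inr (((TateTowerTheta.coord φ₃ S y (Sum.inl c)).map_pow _ _).trans ?_)
    have h0 : TateTowerTheta.coord φ₃ S y (Sum.inl c) (thetaPolesFamOf hS s₀ hstab m) = 1 := by
      change Multiplicative.ofAdd (Multiplicative.toAdd ((thetaPolesFamOf hS s₀ hstab m).1 y) (Sum.inl c)).toNat = 1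
      rw [toAdd_thetaPolesFamOf_inl, Int.toNat_zero, ofAdd_zero]
    rw [h0, one_pow]
  · refine Or.inl (((TateTowerTheta.coord φ₃ S y (Sum.inr j)).map_pow _ _).trans ?_)
    have h0 : TateTowerTheta.coord φ₃ S y (Sum.inr j) (thetaZerosFamOf S m) = 1 := by
      change Multiplicative.ofAdd (Multiplicative.toAdd ((thetaZerosFamOf S m).1 y) (Sum.inr j)).toNat = 1
      rw [toAdd_thetaZerosFamOf_inr, Int.toNat_zero, ofAdd_zero]
    rw [h0, one_pow]

/-- Hence their classes in `Φ₀(S)^pf` are COPRIME. [cite: MochizukiEtTh2009, Def 4.1 (i) p.86] -/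
theorem perfection_coprime_thetaZerosFamOf_pow (ξ : Perfection ((towerC₃sf.act m).phiZero S))
    (hz : ξ ∣ Perfection.of _ (thetaZerosFamOf S m ^ ((N m : ℕ+) : ℕ)))
    (hp : ξ ∣ Perfection.of _ (thetaPolesFamOf hS s₀ hstab m ^ ((N m : ℕ+) : ℕ))) : ξ = 1 :=
  (TateTowerTheta.perfection_coprime_iff_coord φ₃ S _ _ 1 1).2 (coord_thetaZerosFamOf_pow_eq_one_or hS s₀ hstab m) ξ hz hp

end Family

end ThetaTwistTowerTempered

end Literature.AnabelianGeometry.EtaleTheta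

end
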